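import Summits.QuantumFields.YangMills.Theorems.BalabanUVNodesN12NearFlatFederbushFibreRecord
import Literature.MathematicalPhysics.QuantumFieldTheory.Balaban1983to89.B16Ineq17NearFlatDatumFamily
import Literature.MathematicalPhysics.QuantumFieldTheory.Balaban1983to89.B16Ineq17SliceTwist

/-!
# DAG node N12 [B15] — THE FEDERBUSH FIBRE LETTER `hm` AT THE CURVED CHART OF RECORD, THROUGH THE TWIST: the `hm` clause of the assembled endpoint's package (N)
# ([LF-II] (1.7) p. 358 at `U₀ = exp(iA₀) ≠ 1`, p. 357) from this seat's flat-datum letter (p604917), the twisted datum velocity (β3) (p608042) and the twist letter (T) (p605427)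

Cell `pub-ymgap`, HUMAN RULING D-0062 ∕ D-0149, width seat `pub-ymgap-dag-n12-w4` generation 3 (WIDTH SEAT 4 of 4 on N12; lane U2c «assembler of the (L2) display route at the record»;
INBOX CLAIM-2 ∕ INTENT-2 of 2026-08-28).  `--kind proof --supports stmt-QuantumFields-20542 --as helper` (K1⁷; count-neutral).  NEW leaf; CONSUMED BY NAME, nothing modified: this seat's g2
`…N12NearFlatFederbushFibreRecord.hm_federbush_atBj_of_fderiv_msChart_one_eq` (p604917), `…N12NearFlatFederbushFibre.exists_su2ReCoord` ∕ `lieSU2Coord_reCoord_eq` (p602396),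
`B16Ineq17NearFlatDatumFamily.fderiv_msChart_comp_apply_top_of_isMinimizer_family` (p608042, (β3)), `B16Ineq17SliceTwist.circ_twist_ge_sub` (p605427, (T)), `Node00.coe_specialUnitaryAd_inv`
(p606233), the tree's `T4QuatExpLog.norm_quatMatrix` ∕ `T4HaarSU2ExpChart.norm_imQuat`.

[Balaban1989LargeFieldII] = «[LF-II]», p. 357 («we write U₀ = exp(iA₀) and expand in A₀ up to first order … |A₀|, |∇A₀| < O(1)M⁶R_kε_k»), (1.7) p. 358, (1.12) p. 359, (1.19) p. 360;
[Balaban1989LargeFieldI] = «[IV]», (1.74) p. 192, Prop. 1 p. 194; [Balaban1988Convergent] = «[III]», (2.10)–(2.13) pp. 256–257; [Balaban1985Variational] = «[15]», (45) p. 285, (82)–(83) p. 290.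

WHY.  The lane owner's assembled endpoint `B15Prop1EndpointNearFlatLetters` (dag-n12-c p610003; its junction `B15Prop1SliceHessianOfChartFamily` §4, p604041) carries per slice vector `X` the clause
`∃ m, (∀ w′, Lf w′ = DΨ(0)(X_f′X) → m ≤ D²(A∘expChart 1)(0)(w′,w′)) ∧ γ₀·circ(X) ≤ m` at the CURVED chart `Ψ := msChart F 2 K k 𝐁_k(Z) (M˙(Q_k^{s*}Ṽ)) U₀`.  This seat's g2 produced the
Federbush fibre letter at the FLAT linearised fibre `Lf := DΦ♭(0)`, `Φ♭ := msChart … (M˙1) 1` (p604917: every `w′` with `Lf w′ = y`, `y` carrying `φ(ιA X)` at the level-`k` constrained bonds,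
has `((L^d)^k∕(L²L²)^k)·circ(X) ≤ D²(A∘expChart 1)(0)(w′,w′)`), and LOCATED (R2, INBOX 04:10Z) that at a curved `U₀` the value `y = DΨ(0)(X_f′X)` carries at `(k,c)` not `φ(ιA X c)` but the
TWISTED `Ad_{W_k(c)⁻¹} φ(ιA X c)` — (β3), p608042 — so p604917 applies to the twisted slice vector `X̃` (`ιA X̃ c = ρ(W_k(c))(ιA X c)`, `ρ` the rotation of `ℝ³` covering `Ad_{W⁻¹}` through
dag-n12-w3's coordinate `φ`), and the twist letter (T), p605427, returns to `circ(X)` at the price `16(d+1)τ‖X‖²`, `τ∕2 ≥ ‖W_k(c) − 1‖`.  THIS MODULE composes the three by name: the `hm`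
clause at the curved chart in the PRODUCIBLE shape `γ₀·(circ X − 16(d+1)τ‖X‖²) ≤ m`, `γ₀ = (L^d)^k∕(L²L²)^k` (`= 1` in `d = 4`).

CONTENTS (namespace `Summit.QuantumFields.YangMills.BalabanUVNodes.N12NearFlatFederbushFibreTwisted`; theorems only — no `def`, no `instance`, no `sorry`).
* §1 `norm_star_mul_mul_sub_le` (`‖W*ZW − Z‖ ≤ 2‖W − 1‖‖Z‖` for unitary `W`), ★ `exists_rotE3_of_lieSU2Coord` (the rotation action of `SU(2)` on the `ℝ³` coordinate: `φ(ρ W v) = Ad_{W⁻¹} φ(v)`,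
  `‖ρ W v − v‖ ≤ 2‖W − 1‖‖v‖`).
* §2 ★ `exists_twistSlice` (bond-wise linear maps act on the slice: `∃ X̃, ∀ b, ιA X̃ b = R_b (ιA X b)`), `twistSlice_close` (relative closeness from `‖R_b v − v‖ ≤ τ‖v‖`).
* §3 ★★★ `hm_federbush_atBj_twisted_of_isMinimizer_family` (the `hm` clause at the curved chart of record), ★★ `exists_m_hm_twisted_of_isMinimizer_family` (J-C packaging `∃ m, hm ∧ γ₀·circ X − γ₀·16(d+1)τ‖X‖² ≤ m`),
  `exists_m_hm_twisted_of_isMinimizer_family_dim4` (`d = 4`: `γ₀ = 1`), `twistSize_of_isMinimizer_family` (`hW` read on `M˙(U₀)` through the fibre condition at `Y = 0`),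
  ★★★ `exists_m_hm_twisted_window_of_isMinimizer_family` (the KNIT's edition: the auxiliary letters `Q`, `Sset`, `hwin`, `hS` of p604917 DISCHARGED — `Q` := the `linAvg` iterate, `S_i` := everything
  below `k` and the window's image at `k` — so the only geometry left is the placement letter ON THE WINDOW, `hΩw`).

DECIDABILITY CONVENTION: stated at the tree's ambient bond decidability (the instance p608042 is elaborated with; p604917's section instance is instantiated by it), as in
dag-n12-c's p610003.  HONEST FRAMING: slice algebra and composition by name; p604917's region binders (`Q`, `Sset`, `hwin`, `hS`), the placement letter `hΩk`, the minimiser-family letter (K′) `hmin`, the chart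
differentiability `hΨ` and the twist size `hW` stay DISPLAYED; nothing of Bałaban's asserted; N12 NOT discharged; K1⁷ NOT closed; counts unmoved (5∕27); one finite 𝕋⁴ programme at fixed ε — R4
closes the conditional finite-𝕋⁴ rung `BalabanLadder.UV` only; the Yang–Mills mass gap (Clay) is NOT proved by any of this; nothing continuum ∕ ℝ⁴ ∕ OS.
-/

noncomputable section

open scoped BigOperators Matrix.Norms.L2Operator
open Filter Topology Finset

namespace Summit.QuantumFields.YangMills.BalabanUVNodes.N12NearFlatFederbushFibreTwisted

open Literature.MathematicalPhysics.QuantumFieldTheory.Balaban1983to89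
open Literature.MathematicalPhysics.QuantumLattice (quatMatrix)
open T4Continuum (T4Family)
open T4HaarSU2ExpChart (imQuat norm_imQuat)
open T4QuatExpLog (norm_quatMatrix)
open T4AdjointCovarianceUnitary (lieSU specialUnitaryAd)
open B15DeterminingSets GaugeField
open B14.Eq213DetSet (Bj maxDomT)
open B15Prop1SliceCoordinates (GaugeSlice ιA freeBonds ιA_apply_of_mem ιA_apply_of_not_mem)
open B15Prop1ChartSU2 (su2Chart)
open B16Sect1Backgrounds (expMul)
open T4AxialGaugeSmallField (castSite)
open B6TreeGaugePoincare (curl)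
open B16Eq18Proof (box)
open LatticeFieldCalculus (runSite)
open BlockAveragingEMLLinearised (linAvg)
open Literature.MathematicalPhysics.QuantumFieldTheory.BalabanImbrieJaffe1984to88.BIJ85Eq453GaugeField (qsstarGIter0)
open Node00
open Summit.QuantumFields.YangMills.BalabanUVNodes.N12NearFlatFederbushFibre (exists_su2ReCoord lieSU2Coord_reCoord_eq)
open Summit.QuantumFields.YangMills.BalabanUVNodes.N12NearFlatFederbushFibreRecord (hm_federbush_atBj_of_fderiv_msChart_one_eq)
open B16Ineq17NearFlatDatumFamily (fderiv_msChart_comp_apply_top_of_isMinimizer_family)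
open B16Ineq17SliceTwist (circ_twist_ge_sub)

/-! ## §1  `SU(2)` acts on the `ℝ³` coordinate by rotations covering `Ad_{W⁻¹}` -/

section Rotation

/-- `‖W*·Z·W − Z‖ ≤ 2‖W − 1‖·‖Z‖` for `W ∈ SU(2)` (operator norms): `W*ZW − Z = W*Z(W − 1) + (W* − 1)Z`, `‖W*‖ = 1`, `‖W* − 1‖ = ‖W − 1‖`.
[cite: Balaban1989LargeFieldII, p.357 (bookkeeping: first order in A₀); Balaban1985Averaging, (17)–(19) p.21] -/
theorem norm_star_mul_mul_sub_le (W : SU 2) (Z : Matrix (Fin 2) (Fin 2) ℂ) :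
    ‖star ((W : SU 2) : Matrix (Fin 2) (Fin 2) ℂ) * Z * (W : Matrix (Fin 2) (Fin 2) ℂ) - Z‖
      ≤ 2 * ‖((W : SU 2) : Matrix (Fin 2) (Fin 2) ℂ) - 1‖ * ‖Z‖ := by
  set w : Matrix (Fin 2) (Fin 2) ℂ := ((W : SU 2) : Matrix (Fin 2) (Fin 2) ℂ) with hw
  have hsplit : star w * Z * w - Z = star w * Z * (w - 1) + (star w - 1) * Z := by noncomm_ring
  have hstar1 : ‖star w‖ = 1 := CStarRing.norm_of_mem_unitary (Unitary.star_mem W.2.1)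
  have hstar : ‖star w - 1‖ = ‖w - 1‖ := by
    rw [← norm_star (star w - 1), star_sub, star_star, star_one]
  calc ‖star w * Z * w - Z‖ = ‖star w * Z * (w - 1) + (star w - 1) * Z‖ := by rw [hsplit]
    _ ≤ ‖star w * Z * (w - 1)‖ + ‖(star w - 1) * Z‖ := norm_add_le _ _
    _ ≤ ‖star w‖ * ‖Z‖ * ‖w - 1‖ + ‖star w - 1‖ * ‖Z‖ := by
        gcongr
        · exact (norm_mul_le _ _).trans (mul_le_mul_of_nonneg_right (norm_mul_le _ _) (norm_nonneg _))
        · exact norm_mul_le _ _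
    _ = 2 * ‖w - 1‖ * ‖Z‖ := by rw [hstar1, hstar]; ring

/-- ★ **`SU(2)` ACTS ON THE `ℝ³` COORDINATE BY ROTATIONS COVERING `Ad_{W⁻¹}`**: for dag-n12-w3's coordinate `φ : ℝ³ → 𝔰𝔲(2)`, `↑(φ v) = quatMatrix (ι v)`, there are linear maps `ρ W` of `ℝ³`
with `φ(ρ W v) = Ad_{W⁻¹}(φ v)` and `‖ρ W v − v‖ ≤ 2‖W − 1‖·‖v‖` (`ρ W := ψ ∘ Ad_{W⁻¹} ∘ φ` with this seat's inverse coordinate `ψ`; `ψ` is isometric on `𝔰𝔲(2)` because `quatMatrix ∘ ι` is).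
[cite: Balaban1989LargeFieldII, (1.19) p.360, p.357; Balaban1985Averaging, (17) p.21] -/
theorem exists_rotE3_of_lieSU2Coord {φ : EuclideanSpace ℝ (Fin 3) →ₗ[ℝ] lieSU (Fin 2)}
    (hφ : ∀ v, ((φ v : lieSU (Fin 2)) : Matrix (Fin 2) (Fin 2) ℂ) = quatMatrix (imQuat v)) :
    ∃ ρ : SU 2 → (EuclideanSpace ℝ (Fin 3) →ₗ[ℝ] EuclideanSpace ℝ (Fin 3)),
      (∀ W v, φ (ρ W v) = specialUnitaryAd W⁻¹ (φ v)) ∧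
        ∀ W v, ‖ρ W v - v‖ ≤ 2 * ‖((W : SU 2) : Matrix (Fin 2) (Fin 2) ℂ) - 1‖ * ‖v‖ := by
  obtain ⟨ψ, hψv, hψZ⟩ := exists_su2ReCoord
  -- `ψ` is isometric on `𝔰𝔲(2)`
  have hiso : ∀ Z : lieSU (Fin 2), ‖ψ (Z : Matrix (Fin 2) (Fin 2) ℂ)‖ = ‖(Z : Matrix (Fin 2) (Fin 2) ℂ)‖ := fun Z => by
    conv_rhs => rw [← hψZ Z]
    rw [norm_quatMatrix, norm_imQuat]
  refine ⟨fun W => ψ ∘ₗ ((lieSU (Fin 2)).subtype ∘ₗ ((specialUnitaryAd W⁻¹).toLinearEquiv.toLinearMap ∘ₗ φ)), fun W v => ?_, fun W v => ?_⟩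
  · show φ (ψ ((specialUnitaryAd W⁻¹ (φ v) : lieSU (Fin 2)) : Matrix (Fin 2) (Fin 2) ℂ)) = specialUnitaryAd W⁻¹ (φ v)
    exact lieSU2Coord_reCoord_eq hφ hψZ _
  · show ‖ψ ((specialUnitaryAd W⁻¹ (φ v) : lieSU (Fin 2)) : Matrix (Fin 2) (Fin 2) ℂ) - v‖ ≤ _
    have hdiff : ψ ((specialUnitaryAd W⁻¹ (φ v) : lieSU (Fin 2)) : Matrix (Fin 2) (Fin 2) ℂ) - v
        = ψ (((specialUnitaryAd W⁻¹ (φ v) - φ v : lieSU (Fin 2)) : Matrix (Fin 2) (Fin 2) ℂ)) := by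
      rw [Submodule.coe_sub, map_sub, hφ v, hψv]
    have hnv : ‖((φ v : lieSU (Fin 2)) : Matrix (Fin 2) (Fin 2) ℂ)‖ = ‖v‖ := by rw [hφ, norm_quatMatrix, norm_imQuat]
    have h := norm_star_mul_mul_sub_le W ((φ v : lieSU (Fin 2)) : Matrix (Fin 2) (Fin 2) ℂ)
    rw [hnv] at h
    rw [hdiff, hiso, Submodule.coe_sub, coe_specialUnitaryAd_inv]
    exact h

end Rotation

/-! ## §2  Bond-wise linear maps act on the slice -/

section Slice

variable {P : Params} {k : ℕ}

/-- ★ **BOND-WISE LINEAR MAPS ACT ON THE SLICE**: for `X ∈ GaugeSlice S T ℝ³` and linear maps `R_b` of `ℝ³`, the bond field `b ↦ R_b(ιA X b)` is again (the image of) a slice vector — it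
vanishes off the free bonds. [cite: Balaban1989LargeFieldII, p.359 (the gauge-fixed coordinates), p.357] -/
theorem exists_twistSlice {S : Set (Site P k)} {T : Finset (PBond P k)} (X : GaugeSlice S T (EuclideanSpace ℝ (Fin 3)))
    (R : PBond P k → EuclideanSpace ℝ (Fin 3) →ₗ[ℝ] EuclideanSpace ℝ (Fin 3)) :
    ∃ X' : GaugeSlice S T (EuclideanSpace ℝ (Fin 3)), ∀ b, ιA S T X' b = R b (ιA S T X b) := by
  refine ⟨WithLp.toLp 2 (fun i : ↥(freeBonds S T) => R i.1 (X i)), fun b => ?_⟩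
  by_cases h : b ∈ freeBonds S T
  · rw [ιA_apply_of_mem _ h, ιA_apply_of_mem _ h]
  · rw [ιA_apply_of_not_mem _ h, ιA_apply_of_not_mem _ h, map_zero]

/-- Relative closeness of the twisted slice vector: `‖R_b v − v‖ ≤ τ‖v‖` for all `b, v` gives `‖ιA X̃ b − ιA X b‖ ≤ τ‖ιA X b‖` — the hypothesis of the twist letter (T).
[cite: Balaban1989LargeFieldII, p.357 (bookkeeping)] -/
theorem twistSlice_close {S : Set (Site P k)} {T : Finset (PBond P k)} {X X' : GaugeSlice S T (EuclideanSpace ℝ (Fin 3))}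
    {R : PBond P k → EuclideanSpace ℝ (Fin 3) →ₗ[ℝ] EuclideanSpace ℝ (Fin 3)} (hX' : ∀ b, ιA S T X' b = R b (ιA S T X b))
    {τ : ℝ} (hR : ∀ b v, ‖R b v - v‖ ≤ τ * ‖v‖) (b : PBond P k) :
    ‖ιA S T X' b - ιA S T X b‖ ≤ τ * ‖ιA S T X b‖ := by
  rw [hX']
  exact hR b _

end Slice

/-! ## §3  The `hm` clause at the curved chart of record, through the twist -/

section Record

variable {F : T4Family} {K k M₁ : ℕ}

/-- ★★★ **THE FEDERBUSH FIBRE LETTER `hm` AT THE CURVED CHART OF RECORD, THROUGH THE TWIST.**  DATA (displayed): p604917's region binders (`Q` the `linAvg` recursion, a non-wrapping window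
`box m lo` whose `castSite`-image lies in `S_k`, nested plaquette-site sets `S_i` closed under the block runs, the coordinate `φ`, the placement letter `hΩk` «the window's `(e₀,e_ν)`-plaquette
corners are `k`-points of `Ω_k(Z) = maxDomT M₁ Z k`»); the minimiser-family letter (K′) `hmin` of the lane owner's (J-C) package at the datum `M˙(Q_k^{s*}V)` with its chart family `X_f`
(`X_f 0 = 0`, derivative `X_f′` at `0`) and the chart's differentiability at `0` (`hΨ`); and the TWIST SIZE `hW : ‖M˙(Q_k^{s*}V)_k(c) − 1‖ ≤ τ∕2` at the level-`k` constrained bonds (`0 < τ`).  THEN,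
for the slice vector `X`: every fine field `w′` whose FLAT linearised constraint value `DΦ♭(0)w′` (`Φ♭ := msChart … (M˙1) 1`) equals the CURVED datum velocity `DΨ(0)(X_f′X)`
(`Ψ := msChart … (M˙(Q_k^{s*}V)) U₀`) satisfies `((L^d)^k∕(L²L²)^k)·(circ(X) − 16(d+1)τ‖X‖²) ≤ D²(A∘expChart 1)(0)(w′,w′)`.  Proof: (β3) identifies the top components of `DΨ(0)(X_f′X)` as
`Ad_{W_k(c)⁻¹}φ(ιA X c) = φ(ιA X̃ c)` for the twisted slice vector `X̃` (§1–§2), p604917 at `X̃` gives `γ₀·circ(X̃) ≤ …`, and (T) gives `circ(X̃) ≥ circ(X) − 16(d+1)τ‖X‖²`.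
[cite: Balaban1989LargeFieldII, (1.7) pp.357–358, (1.12) p.359, (1.19) p.360; Balaban1989LargeFieldI, (1.74) p.192, Prop. 1 p.194; Balaban1988Convergent, (2.10)–(2.13) pp.256–257; Balaban1985Variational, (45) p.285, (82)–(83) p.290] -/
theorem hm_federbush_atBj_twisted_of_isMinimizer_family (h0 : 0 < (F.P K).d) (hk : k ≤ (F.P K).m + (F.P K).K)
    (Q : (i : ℕ) → (PBond (F.P K) 0 → Matrix (Fin 2) (Fin 2) ℂ) → PBond (F.P K) i → Matrix (Fin 2) (Fin 2) ℂ)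
    (hQ0 : ∀ Y, Q 0 Y = Y) (hQs : ∀ (i : ℕ) (Y : PBond (F.P K) 0 → Matrix (Fin 2) (Fin 2) ℂ) (c : PBond (F.P K) (i + 1)), Q (i + 1) Y c = linAvg (Q i Y) c)
    (Z : Set (Site (F.P K) 0)) {S : Set (Site (F.P K) k)} {T : Finset (PBond (F.P K) k)} (X : GaugeSlice S T (EuclideanSpace ℝ (Fin 3)))
    {m : Fin (F.P K).d → ℕ} (lo : Fin (F.P K).d → ℤ) (hm : ∀ κ, (m κ : ℤ) ≤ (F.P K).sitesPerDir k)
    (Sset : (i : ℕ) → Finset (Site (F.P K) i)) (hwin : ∀ z ∈ box m lo, (castSite z : Site (F.P K) k) ∈ Sset k)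
    (hS : ∀ (ν : Fin (F.P K).d), (⟨0, h0⟩ : Fin (F.P K).d) ≠ ν → ∀ i, i < k → ∀ y ∈ Sset (i + 1), ∀ (r : Fin (F.P K).d → Fin (F.P K).L) (s t : ℕ),
      s < (F.P K).L → t < (F.P K).L → runSite (runSite (Site.blockSite y r) ⟨0, h0⟩ s) ν t ∈ Sset i)
    {φ : EuclideanSpace ℝ (Fin 3) →ₗ[ℝ] lieSU (Fin 2)} (hφ : ∀ v, ((φ v : lieSU (Fin 2)) : Matrix (Fin 2) (Fin 2) ℂ) = quatMatrix (imQuat v))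
    (hΩk : ∀ (ν : Fin (F.P K).d), ∀ s ∈ Sset k, s ∈ pts k (maxDomT M₁ Z k) ∧ s.shift ⟨0, h0⟩ ∈ pts k (maxDomT M₁ Z k) ∧ s.shift ν ∈ pts k (maxDomT M₁ Z k))
    -- the (K′) family of the lane owner's package at the datum `M˙(Q_k^{s*}V)`, and the chart's differentiability at `0`
    (reg : Set (GaugeField (F.P K) 0 (SU 2))) (V : GaugeField (F.P K) k (SU 2)) (U₀ : GaugeField (F.P K) 0 (SU 2))
    {Xf : GaugeSlice S T (EuclideanSpace ℝ (Fin 3)) → PBond (F.P K) 0 → lieSU (Fin 2)} (hX₀ : Xf 0 = 0)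
    (hmin : ∀ᶠ Y in 𝓝 (0 : GaugeSlice S T (EuclideanSpace ℝ (Fin 3))),
      IsMinimizer (avOfRecord F 2 K) reg (Bj M₁ Z k) (avgFamily (avOfRecord F 2 K) (qsstarGIter0 k (expMul su2Chart (ιA S T Y) V))) (expChart U₀ (Xf Y)))
    {X' : GaugeSlice S T (EuclideanSpace ℝ (Fin 3)) →L[ℝ] PBond (F.P K) 0 → lieSU (Fin 2)} (hX : HasFDerivAt Xf X' 0)
    (hΨ : DifferentiableAt ℝ (msChart F 2 K k (Bj M₁ Z k) (avgFamily (avOfRecord F 2 K) (qsstarGIter0 k V)) U₀) 0)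
    -- the twist size at the level-`k` constrained bonds
    {τ : ℝ} (hτ : 0 < τ)
    (hW : ∀ c ∈ bondsOf (Bj M₁ Z k k), ‖((avgFamily (avOfRecord F 2 K) (qsstarGIter0 k V) k c : SU 2) : Matrix (Fin 2) (Fin 2) ℂ) - 1‖ ≤ τ / 2) :
    ∀ w' : PBond (F.P K) 0 → lieSU (Fin 2),
      fderiv ℝ (msChart F 2 K k (Bj M₁ Z k) (avgFamily (avOfRecord F 2 K) (1 : GaugeField (F.P K) 0 (SU 2))) (1 : GaugeField (F.P K) 0 (SU 2))) 0 w'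
          = fderiv ℝ (msChart F 2 K k (Bj M₁ Z k) (avgFamily (avOfRecord F 2 K) (qsstarGIter0 k V)) U₀) 0 (X' X) →
      (((F.P K).L : ℝ) ^ (F.P K).d) ^ k / ((((F.P K).L : ℝ)) ^ 2 * ((F.P K).L : ℝ) ^ 2) ^ k *
          ((∑ z ∈ box m lo, ∑ μ : Fin (F.P K).d, ∑ a : Fin 3, curl (fun b => ιA S T X (⟨castSite b.1, b.2⟩ : PBond (F.P K) k) a) z ⟨0, h0⟩ μ ^ 2)
            - 16 * (((F.P K).d : ℝ) + 1) * τ * ‖X‖ ^ 2)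
        ≤ fderiv ℝ (fun Y => fderiv ℝ (fun Y : PBond (F.P K) 0 → lieSU (Fin 2) => wilsonAction4 (expChart (1 : GaugeField (F.P K) 0 (SU 2)) Y)) Y) 0 w' w' := by
  classical
  intro w' hw'
  set W : MSField (F.P K) (SU 2) := avgFamily (avOfRecord F 2 K) (qsstarGIter0 k V) with hWdef
  -- §1: the rotations; the bond-wise twist `R_b := ρ(W_k(b))` at the constrained bonds, the identity elsewhere
  obtain ⟨ρ, hρφ, hρn⟩ := exists_rotE3_of_lieSU2Coord hφ
  let R : PBond (F.P K) k → EuclideanSpace ℝ (Fin 3) →ₗ[ℝ] EuclideanSpace ℝ (Fin 3) := fun b =>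
    if b ∈ bondsOf (Bj M₁ Z k k) then ρ (W k b) else LinearMap.id
  have hRn : ∀ b v, ‖R b v - v‖ ≤ τ * ‖v‖ := by
    intro b v
    by_cases hb : b ∈ bondsOf (Bj M₁ Z k k)
    · have h1 : R b = ρ (W k b) := if_pos hb
      rw [h1]
      calc ‖ρ (W k b) v - v‖ ≤ 2 * ‖((W k b : SU 2) : Matrix (Fin 2) (Fin 2) ℂ) - 1‖ * ‖v‖ := hρn _ _
        _ ≤ 2 * (τ / 2) * ‖v‖ := by gcongr; exact hW b hb
        _ = τ * ‖v‖ := by ring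
    · have h1 : R b = LinearMap.id := if_neg hb
      rw [h1, LinearMap.id_apply, sub_self, norm_zero]
      positivity
  -- §2: the twisted slice vector
  obtain ⟨Xt, hXt⟩ := exists_twistSlice X R
  have hclose : ∀ b, ‖ιA S T Xt b - ιA S T X b‖ ≤ τ * ‖ιA S T X b‖ := twistSlice_close hXt hRn
  -- (β3): the top components of the curved datum velocity are the twisted coordinates
  have hΨ' : DifferentiableAt ℝ (msChart F 2 K k (Bj M₁ Z k) W U₀) (Xf 0) := by rw [hX₀]; exact hΨ
  have hy : ∀ (b : PBond (F.P K) k) (hb : b ∈ bondsOf (Bj M₁ Z k k)),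
      fderiv ℝ (msChart F 2 K k (Bj M₁ Z k) W U₀) 0 (X' X) (constrEnum (Bj M₁ Z k) k ⟨Fin.last k, ⟨b, hb⟩⟩) = φ (ιA S T Xt b) := by
    intro b hb
    have h := fderiv_msChart_comp_apply_top_of_isMinimizer_family S T hk hφ (Bj M₁ Z k) reg V U₀ hmin hX hΨ' X b hb
    rw [hX₀] at h
    rw [h, hXt b, ← hρφ]
    congr 1
    show ρ (W k b) (ιA S T X b) = R b (ιA S T X b)
    have h1 : R b = ρ (W k b) := if_pos hb
    rw [h1]
  -- p604917 at the twisted slice vector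
  have hflat := hm_federbush_atBj_of_fderiv_msChart_one_eq (M₁ := M₁) h0 hk Q hQ0 hQs Z Xt lo hm Sset hwin hS hφ hΩk
    (y := fderiv ℝ (msChart F 2 K k (Bj M₁ Z k) W U₀) 0 (X' X)) hy w' hw'
  -- (T): return to `circ X`
  have htwist := circ_twist_ge_sub h0 X Xt hτ hclose lo hm
  have hratio : 0 ≤ (((F.P K).L : ℝ) ^ (F.P K).d) ^ k / ((((F.P K).L : ℝ)) ^ 2 * ((F.P K).L : ℝ) ^ 2) ^ k := by positivity
  exact (mul_le_mul_of_nonneg_left htwist hratio).trans hflat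

/-- ★★ **THE `hm` CLAUSE OF THE PACKAGE (N), PACKAGED AS THE LANE OWNER's JUNCTION READS IT** (`B15Prop1EndpointNearFlatLetters` ∕ `B15Prop1SliceHessianOfChartFamily` §4): with `Lf := DΦ♭(0)`
the flat linearised constraint and `γ₀ := (L^d)^k∕(L²L²)^k`, there is `m` with `∀ w′, Lf w′ = DΨ(0)(X_f′X) → m ≤ D²(A∘expChart 1)(0)(w′,w′)` AND `γ₀·circ(X) − γ₀·16(d+1)τ‖X‖² ≤ m` — the producible
shape of the clause at a curved `U₀` (the twist loss joins `Cerr`). [cite: Balaban1989LargeFieldII, (1.7) pp.357–358, (1.12) p.359; Balaban1989LargeFieldI, Prop. 1 p.194] -/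
theorem exists_m_hm_twisted_of_isMinimizer_family (h0 : 0 < (F.P K).d) (hk : k ≤ (F.P K).m + (F.P K).K)
    (Q : (i : ℕ) → (PBond (F.P K) 0 → Matrix (Fin 2) (Fin 2) ℂ) → PBond (F.P K) i → Matrix (Fin 2) (Fin 2) ℂ)
    (hQ0 : ∀ Y, Q 0 Y = Y) (hQs : ∀ (i : ℕ) (Y : PBond (F.P K) 0 → Matrix (Fin 2) (Fin 2) ℂ) (c : PBond (F.P K) (i + 1)), Q (i + 1) Y c = linAvg (Q i Y) c)
    (Z : Set (Site (F.P K) 0)) {S : Set (Site (F.P K) k)} {T : Finset (PBond (F.P K) k)} (X : GaugeSlice S T (EuclideanSpace ℝ (Fin 3)))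
    {m : Fin (F.P K).d → ℕ} (lo : Fin (F.P K).d → ℤ) (hm : ∀ κ, (m κ : ℤ) ≤ (F.P K).sitesPerDir k)
    (Sset : (i : ℕ) → Finset (Site (F.P K) i)) (hwin : ∀ z ∈ box m lo, (castSite z : Site (F.P K) k) ∈ Sset k)
    (hS : ∀ (ν : Fin (F.P K).d), (⟨0, h0⟩ : Fin (F.P K).d) ≠ ν → ∀ i, i < k → ∀ y ∈ Sset (i + 1), ∀ (r : Fin (F.P K).d → Fin (F.P K).L) (s t : ℕ),
      s < (F.P K).L → t < (F.P K).L → runSite (runSite (Site.blockSite y r) ⟨0, h0⟩ s) ν t ∈ Sset i)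
    {φ : EuclideanSpace ℝ (Fin 3) →ₗ[ℝ] lieSU (Fin 2)} (hφ : ∀ v, ((φ v : lieSU (Fin 2)) : Matrix (Fin 2) (Fin 2) ℂ) = quatMatrix (imQuat v))
    (hΩk : ∀ (ν : Fin (F.P K).d), ∀ s ∈ Sset k, s ∈ pts k (maxDomT M₁ Z k) ∧ s.shift ⟨0, h0⟩ ∈ pts k (maxDomT M₁ Z k) ∧ s.shift ν ∈ pts k (maxDomT M₁ Z k))
    (reg : Set (GaugeField (F.P K) 0 (SU 2))) (V : GaugeField (F.P K) k (SU 2)) (U₀ : GaugeField (F.P K) 0 (SU 2))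
    {Xf : GaugeSlice S T (EuclideanSpace ℝ (Fin 3)) → PBond (F.P K) 0 → lieSU (Fin 2)} (hX₀ : Xf 0 = 0)
    (hmin : ∀ᶠ Y in 𝓝 (0 : GaugeSlice S T (EuclideanSpace ℝ (Fin 3))),
      IsMinimizer (avOfRecord F 2 K) reg (Bj M₁ Z k) (avgFamily (avOfRecord F 2 K) (qsstarGIter0 k (expMul su2Chart (ιA S T Y) V))) (expChart U₀ (Xf Y)))
    {X' : GaugeSlice S T (EuclideanSpace ℝ (Fin 3)) →L[ℝ] PBond (F.P K) 0 → lieSU (Fin 2)} (hX : HasFDerivAt Xf X' 0)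
    (hΨ : DifferentiableAt ℝ (msChart F 2 K k (Bj M₁ Z k) (avgFamily (avOfRecord F 2 K) (qsstarGIter0 k V)) U₀) 0)
    {τ : ℝ} (hτ : 0 < τ)
    (hW : ∀ c ∈ bondsOf (Bj M₁ Z k k), ‖((avgFamily (avOfRecord F 2 K) (qsstarGIter0 k V) k c : SU 2) : Matrix (Fin 2) (Fin 2) ℂ) - 1‖ ≤ τ / 2) :
    ∃ m' : ℝ,
      (∀ w' : PBond (F.P K) 0 → lieSU (Fin 2),
        fderiv ℝ (msChart F 2 K k (Bj M₁ Z k) (avgFamily (avOfRecord F 2 K) (1 : GaugeField (F.P K) 0 (SU 2))) (1 : GaugeField (F.P K) 0 (SU 2))) 0 w'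
            = fderiv ℝ (msChart F 2 K k (Bj M₁ Z k) (avgFamily (avOfRecord F 2 K) (qsstarGIter0 k V)) U₀) 0 (X' X) →
        m' ≤ fderiv ℝ (fun Y => fderiv ℝ (fun Y : PBond (F.P K) 0 → lieSU (Fin 2) => wilsonAction4 (expChart (1 : GaugeField (F.P K) 0 (SU 2)) Y)) Y) 0 w' w') ∧
      (((F.P K).L : ℝ) ^ (F.P K).d) ^ k / ((((F.P K).L : ℝ)) ^ 2 * ((F.P K).L : ℝ) ^ 2) ^ k *
            (∑ z ∈ box m lo, ∑ μ : Fin (F.P K).d, ∑ a : Fin 3, curl (fun b => ιA S T X (⟨castSite b.1, b.2⟩ : PBond (F.P K) k) a) z ⟨0, h0⟩ μ ^ 2)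
          - (((F.P K).L : ℝ) ^ (F.P K).d) ^ k / ((((F.P K).L : ℝ)) ^ 2 * ((F.P K).L : ℝ) ^ 2) ^ k * (16 * (((F.P K).d : ℝ) + 1) * τ) * ‖X‖ ^ 2
        ≤ m' := by
  refine ⟨_, hm_federbush_atBj_twisted_of_isMinimizer_family h0 hk Q hQ0 hQs Z X lo hm Sset hwin hS hφ hΩk reg V U₀ hX₀ hmin hX hΨ hτ hW, le_of_eq ?_⟩
  ring

/-- **`d = 4`: the block ratio is `1`**, so the clause reads `circ(X) − 16(d+1)τ‖X‖² ≤ m`. [cite: Balaban1989LargeFieldII, (1.7) p.358; Balaban1989LargeFieldI, (1.74) p.192 (d = 4)] -/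
theorem exists_m_hm_twisted_of_isMinimizer_family_dim4 (hd : (F.P K).d = 4) (h0 : 0 < (F.P K).d) (hk : k ≤ (F.P K).m + (F.P K).K)
    (Q : (i : ℕ) → (PBond (F.P K) 0 → Matrix (Fin 2) (Fin 2) ℂ) → PBond (F.P K) i → Matrix (Fin 2) (Fin 2) ℂ)
    (hQ0 : ∀ Y, Q 0 Y = Y) (hQs : ∀ (i : ℕ) (Y : PBond (F.P K) 0 → Matrix (Fin 2) (Fin 2) ℂ) (c : PBond (F.P K) (i + 1)), Q (i + 1) Y c = linAvg (Q i Y) c)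
    (Z : Set (Site (F.P K) 0)) {S : Set (Site (F.P K) k)} {T : Finset (PBond (F.P K) k)} (X : GaugeSlice S T (EuclideanSpace ℝ (Fin 3)))
    {m : Fin (F.P K).d → ℕ} (lo : Fin (F.P K).d → ℤ) (hm : ∀ κ, (m κ : ℤ) ≤ (F.P K).sitesPerDir k)
    (Sset : (i : ℕ) → Finset (Site (F.P K) i)) (hwin : ∀ z ∈ box m lo, (castSite z : Site (F.P K) k) ∈ Sset k)
    (hS : ∀ (ν : Fin (F.P K).d), (⟨0, h0⟩ : Fin (F.P K).d) ≠ ν → ∀ i, i < k → ∀ y ∈ Sset (i + 1), ∀ (r : Fin (F.P K).d → Fin (F.P K).L) (s t : ℕ),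
      s < (F.P K).L → t < (F.P K).L → runSite (runSite (Site.blockSite y r) ⟨0, h0⟩ s) ν t ∈ Sset i)
    {φ : EuclideanSpace ℝ (Fin 3) →ₗ[ℝ] lieSU (Fin 2)} (hφ : ∀ v, ((φ v : lieSU (Fin 2)) : Matrix (Fin 2) (Fin 2) ℂ) = quatMatrix (imQuat v))
    (hΩk : ∀ (ν : Fin (F.P K).d), ∀ s ∈ Sset k, s ∈ pts k (maxDomT M₁ Z k) ∧ s.shift ⟨0, h0⟩ ∈ pts k (maxDomT M₁ Z k) ∧ s.shift ν ∈ pts k (maxDomT M₁ Z k))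
    (reg : Set (GaugeField (F.P K) 0 (SU 2))) (V : GaugeField (F.P K) k (SU 2)) (U₀ : GaugeField (F.P K) 0 (SU 2))
    {Xf : GaugeSlice S T (EuclideanSpace ℝ (Fin 3)) → PBond (F.P K) 0 → lieSU (Fin 2)} (hX₀ : Xf 0 = 0)
    (hmin : ∀ᶠ Y in 𝓝 (0 : GaugeSlice S T (EuclideanSpace ℝ (Fin 3))),
      IsMinimizer (avOfRecord F 2 K) reg (Bj M₁ Z k) (avgFamily (avOfRecord F 2 K) (qsstarGIter0 k (expMul su2Chart (ιA S T Y) V))) (expChart U₀ (Xf Y)))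
    {X' : GaugeSlice S T (EuclideanSpace ℝ (Fin 3)) →L[ℝ] PBond (F.P K) 0 → lieSU (Fin 2)} (hX : HasFDerivAt Xf X' 0)
    (hΨ : DifferentiableAt ℝ (msChart F 2 K k (Bj M₁ Z k) (avgFamily (avOfRecord F 2 K) (qsstarGIter0 k V)) U₀) 0)
    {τ : ℝ} (hτ : 0 < τ)
    (hW : ∀ c ∈ bondsOf (Bj M₁ Z k k), ‖((avgFamily (avOfRecord F 2 K) (qsstarGIter0 k V) k c : SU 2) : Matrix (Fin 2) (Fin 2) ℂ) - 1‖ ≤ τ / 2) :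
    ∃ m' : ℝ,
      (∀ w' : PBond (F.P K) 0 → lieSU (Fin 2),
        fderiv ℝ (msChart F 2 K k (Bj M₁ Z k) (avgFamily (avOfRecord F 2 K) (1 : GaugeField (F.P K) 0 (SU 2))) (1 : GaugeField (F.P K) 0 (SU 2))) 0 w'
            = fderiv ℝ (msChart F 2 K k (Bj M₁ Z k) (avgFamily (avOfRecord F 2 K) (qsstarGIter0 k V)) U₀) 0 (X' X) →
        m' ≤ fderiv ℝ (fun Y => fderiv ℝ (fun Y : PBond (F.P K) 0 → lieSU (Fin 2) => wilsonAction4 (expChart (1 : GaugeField (F.P K) 0 (SU 2)) Y)) Y) 0 w' w') ∧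
      (∑ z ∈ box m lo, ∑ μ : Fin (F.P K).d, ∑ a : Fin 3, curl (fun b => ιA S T X (⟨castSite b.1, b.2⟩ : PBond (F.P K) k) a) z ⟨0, h0⟩ μ ^ 2)
          - (16 * (((F.P K).d : ℝ) + 1) * τ) * ‖X‖ ^ 2 ≤ m' := by
  obtain ⟨m', h1, h2⟩ := exists_m_hm_twisted_of_isMinimizer_family h0 hk Q hQ0 hQs Z X lo hm Sset hwin hS hφ hΩk reg V U₀ hX₀ hmin hX hΨ hτ hW
  refine ⟨m', h1, ?_⟩
  have hL : ((F.P K).L : ℝ) ≠ 0 := by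
    have : 0 < (F.P K).L := lt_trans Nat.zero_lt_one (F.P K).hL.2
    exact_mod_cast this.ne'
  have hratio : (((F.P K).L : ℝ) ^ (F.P K).d) ^ k / ((((F.P K).L : ℝ)) ^ 2 * ((F.P K).L : ℝ) ^ 2) ^ k = 1 := by
    rw [hd, show (((F.P K).L : ℝ)) ^ 2 * ((F.P K).L : ℝ) ^ 2 = ((F.P K).L : ℝ) ^ 4 by ring, div_self (pow_ne_zero _ (pow_ne_zero _ hL))]
  rw [hratio, one_mul, one_mul] at h2
  exact h2

/-- **THE TWIST SIZE READ ON THE MINIMISER's OWN AVERAGES**: along the (K′) family the datum at `Y = 0` is `M˙(Q_k^{s*}V)`, which AGREES with `M˙(U₀)` on the constrained bonds (the fibre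
condition of `IsMinimizer` at `Y = 0`, `expMul 0 = id`, `X_f 0 = 0`), so `hW` follows from `‖M˙(U₀)_k(c) − 1‖ ≤ τ∕2` at the level-`k` constrained bonds — the quantity the tree bounds by the
bond-wise near-flatness of `U₀` near the block (`…AlphaInputsT3ACv3StartDefectCore.norm_iter_sub_one_le_of_localFlat`: `≤ 2(d+1)L^kδ`; dag-n10-w1's `exists_norm_iterM_sub_one_le`).
[cite: Balaban1989LargeFieldII, p.357 («|A₀|, |∇A₀| < O(1)M⁶R_kε_k»); Balaban1988Convergent, (2.10)–(2.12) p.256] -/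
theorem twistSize_of_isMinimizer_family {S : Set (Site (F.P K) k)} {T : Finset (PBond (F.P K) k)} (Z : Set (Site (F.P K) 0))
    (reg : Set (GaugeField (F.P K) 0 (SU 2))) (V : GaugeField (F.P K) k (SU 2)) (U₀ : GaugeField (F.P K) 0 (SU 2))
    {Xf : GaugeSlice S T (EuclideanSpace ℝ (Fin 3)) → PBond (F.P K) 0 → lieSU (Fin 2)} (hX₀ : Xf 0 = 0)
    (hmin : ∀ᶠ Y in 𝓝 (0 : GaugeSlice S T (EuclideanSpace ℝ (Fin 3))),
      IsMinimizer (avOfRecord F 2 K) reg (Bj M₁ Z k) (avgFamily (avOfRecord F 2 K) (qsstarGIter0 k (expMul su2Chart (ιA S T Y) V))) (expChart U₀ (Xf Y)))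
    {τ : ℝ} (hU : ∀ c ∈ bondsOf (Bj M₁ Z k k), ‖((avgFamily (avOfRecord F 2 K) U₀ k c : SU 2) : Matrix (Fin 2) (Fin 2) ℂ) - 1‖ ≤ τ / 2) :
    ∀ c ∈ bondsOf (Bj M₁ Z k k), ‖((avgFamily (avOfRecord F 2 K) (qsstarGIter0 k V) k c : SU 2) : Matrix (Fin 2) (Fin 2) ℂ) - 1‖ ≤ τ / 2 := by
  intro c hc
  have h0 := hmin.self_of_nhds
  rw [map_zero, B16Sect1Backgrounds.expMul_zero, hX₀, expChart_zero] at h0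
  rw [← h0.2.1 k c hc]
  exact hU c hc

/-- ★★★ **THE SAME WITH THE AUXILIARY LETTERS DISCHARGED — THE WINDOW EDITION FOR THE KNIT**: the `linAvg`-recursion letter `Q` is the iterate of `linAvg` (built here), and the nested
plaquette-site sets are «everything below level `k`, the window's `castSite`-image at level `k`» (closed under the block runs trivially), so the only geometric hypothesis left is the PLACEMENT
LETTER ON THE WINDOW ITSELF `hΩw : ∀ ν, ∀ z ∈ box m lo, castSite z, castSite z + e₀, castSite z + e_ν ∈ Ω_k(Z)^{(k)} = pts k (maxDomT M₁ Z k)`.  Conclusion: the packaged clause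
`∃ m, (∀ w′, DΦ♭(0)w′ = DΨ(0)(X_f′X) → m ≤ D²(A∘expChart 1)(0)(w′,w′)) ∧ γ₀·circ(X) − γ₀·16(d+1)τ‖X‖² ≤ m`, `γ₀ = (L^d)^k∕(L²L²)^k`.
[cite: Balaban1989LargeFieldII, (1.7) pp.357–358, (1.12) p.359; Balaban1989LargeFieldI, (1.74) p.192, Prop. 1 p.194; Balaban1988Convergent, (2.10)–(2.13) pp.256–257] -/
theorem exists_m_hm_twisted_window_of_isMinimizer_family (h0 : 0 < (F.P K).d) (hk : k ≤ (F.P K).m + (F.P K).K)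
    (Z : Set (Site (F.P K) 0)) {S : Set (Site (F.P K) k)} {T : Finset (PBond (F.P K) k)} (X : GaugeSlice S T (EuclideanSpace ℝ (Fin 3)))
    {m : Fin (F.P K).d → ℕ} (lo : Fin (F.P K).d → ℤ) (hm : ∀ κ, (m κ : ℤ) ≤ (F.P K).sitesPerDir k)
    {φ : EuclideanSpace ℝ (Fin 3) →ₗ[ℝ] lieSU (Fin 2)} (hφ : ∀ v, ((φ v : lieSU (Fin 2)) : Matrix (Fin 2) (Fin 2) ℂ) = quatMatrix (imQuat v))
    (hΩw : ∀ (ν : Fin (F.P K).d), ∀ z ∈ box m lo,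
      (castSite z : Site (F.P K) k) ∈ pts k (maxDomT M₁ Z k) ∧ (castSite z : Site (F.P K) k).shift ⟨0, h0⟩ ∈ pts k (maxDomT M₁ Z k) ∧
        (castSite z : Site (F.P K) k).shift ν ∈ pts k (maxDomT M₁ Z k))
    (reg : Set (GaugeField (F.P K) 0 (SU 2))) (V : GaugeField (F.P K) k (SU 2)) (U₀ : GaugeField (F.P K) 0 (SU 2))
    {Xf : GaugeSlice S T (EuclideanSpace ℝ (Fin 3)) → PBond (F.P K) 0 → lieSU (Fin 2)} (hX₀ : Xf 0 = 0)
    (hmin : ∀ᶠ Y in 𝓝 (0 : GaugeSlice S T (EuclideanSpace ℝ (Fin 3))),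
      IsMinimizer (avOfRecord F 2 K) reg (Bj M₁ Z k) (avgFamily (avOfRecord F 2 K) (qsstarGIter0 k (expMul su2Chart (ιA S T Y) V))) (expChart U₀ (Xf Y)))
    {X' : GaugeSlice S T (EuclideanSpace ℝ (Fin 3)) →L[ℝ] PBond (F.P K) 0 → lieSU (Fin 2)} (hX : HasFDerivAt Xf X' 0)
    (hΨ : DifferentiableAt ℝ (msChart F 2 K k (Bj M₁ Z k) (avgFamily (avOfRecord F 2 K) (qsstarGIter0 k V)) U₀) 0)
    {τ : ℝ} (hτ : 0 < τ)
    (hW : ∀ c ∈ bondsOf (Bj M₁ Z k k), ‖((avgFamily (avOfRecord F 2 K) (qsstarGIter0 k V) k c : SU 2) : Matrix (Fin 2) (Fin 2) ℂ) - 1‖ ≤ τ / 2) :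
    ∃ m' : ℝ,
      (∀ w' : PBond (F.P K) 0 → lieSU (Fin 2),
        fderiv ℝ (msChart F 2 K k (Bj M₁ Z k) (avgFamily (avOfRecord F 2 K) (1 : GaugeField (F.P K) 0 (SU 2))) (1 : GaugeField (F.P K) 0 (SU 2))) 0 w'
            = fderiv ℝ (msChart F 2 K k (Bj M₁ Z k) (avgFamily (avOfRecord F 2 K) (qsstarGIter0 k V)) U₀) 0 (X' X) →
        m' ≤ fderiv ℝ (fun Y => fderiv ℝ (fun Y : PBond (F.P K) 0 → lieSU (Fin 2) => wilsonAction4 (expChart (1 : GaugeField (F.P K) 0 (SU 2)) Y)) Y) 0 w' w') ∧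
      (((F.P K).L : ℝ) ^ (F.P K).d) ^ k / ((((F.P K).L : ℝ)) ^ 2 * ((F.P K).L : ℝ) ^ 2) ^ k *
            (∑ z ∈ box m lo, ∑ μ : Fin (F.P K).d, ∑ a : Fin 3, curl (fun b => ιA S T X (⟨castSite b.1, b.2⟩ : PBond (F.P K) k) a) z ⟨0, h0⟩ μ ^ 2)
          - (((F.P K).L : ℝ) ^ (F.P K).d) ^ k / ((((F.P K).L : ℝ)) ^ 2 * ((F.P K).L : ℝ) ^ 2) ^ k * (16 * (((F.P K).d : ℝ) + 1) * τ) * ‖X‖ ^ 2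
        ≤ m' := by
  classical
  -- the `linAvg` iterate
  let Q : (i : ℕ) → (PBond (F.P K) 0 → Matrix (Fin 2) (Fin 2) ℂ) → PBond (F.P K) i → Matrix (Fin 2) (Fin 2) ℂ := fun i =>
    Nat.rec (motive := fun i => (PBond (F.P K) 0 → Matrix (Fin 2) (Fin 2) ℂ) → PBond (F.P K) i → Matrix (Fin 2) (Fin 2) ℂ)
      (fun Y => Y) (fun _ q Y c => linAvg (q Y) c) i
  have hQ0 : ∀ Y, Q 0 Y = Y := fun Y => rfl
  have hQs : ∀ (i : ℕ) (Y : PBond (F.P K) 0 → Matrix (Fin 2) (Fin 2) ℂ) (c : PBond (F.P K) (i + 1)), Q (i + 1) Y c = linAvg (Q i Y) c :=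
    fun i Y c => rfl
  -- the nested plaquette-site sets: everything below level `k`, the window's image at level `k` and above
  let Sset : (i : ℕ) → Finset (Site (F.P K) i) := fun i =>
    if i < k then Finset.univ else (box m lo).image (fun z => (castSite z : Site (F.P K) i))
  have hSk : Sset k = (box m lo).image (fun z => (castSite z : Site (F.P K) k)) := if_neg (lt_irrefl k)
  have hwin : ∀ z ∈ box m lo, (castSite z : Site (F.P K) k) ∈ Sset k := fun z hz => by
    rw [hSk]
    exact Finset.mem_image_of_mem _ hz
  have hS : ∀ (ν : Fin (F.P K).d), (⟨0, h0⟩ : Fin (F.P K).d) ≠ ν → ∀ i, i < k → ∀ y ∈ Sset (i + 1), ∀ (r : Fin (F.P K).d → Fin (F.P K).L) (s t : ℕ),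
      s < (F.P K).L → t < (F.P K).L → runSite (runSite (Site.blockSite y r) ⟨0, h0⟩ s) ν t ∈ Sset i := by
    intro ν _ i hi y _ r s t _ _
    have h1 : Sset i = Finset.univ := if_pos hi
    rw [h1]
    exact Finset.mem_univ _
  have hΩk : ∀ (ν : Fin (F.P K).d), ∀ s ∈ Sset k, s ∈ pts k (maxDomT M₁ Z k) ∧ s.shift ⟨0, h0⟩ ∈ pts k (maxDomT M₁ Z k) ∧ s.shift ν ∈ pts k (maxDomT M₁ Z k) := by
    intro ν s hs
    rw [hSk, Finset.mem_image] at hs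
    obtain ⟨z, hz, rfl⟩ := hs
    exact hΩw ν z hz
  exact exists_m_hm_twisted_of_isMinimizer_family h0 hk Q hQ0 hQs Z X lo hm Sset hwin hS hφ hΩk reg V U₀ hX₀ hmin hX hΨ hτ hW

end Record

end Summit.QuantumFields.YangMills.BalabanUVNodes.N12NearFlatFederbushFibreTwisted

end
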